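import Summits.BirchSwinnertonDyer.BirchSwinnertonDyer.Theorems.SemiOrdinaryEisensteinDescentShaTwoCochainThetaExhaustion
import HarnessLib

/-!
# The Weil transport `θ : E[m] ≅ E[m]^D = Hom(E[m], μ_{m²})` of the descended pairing, and the transport of a `PTChoice`
# to an admissible choice for the EVALUATION pairing with the SAME local cocycles (step E of SHA2-BRIDGE-w3g7; step A imported from w4 g2)

Route `SemiOrdinaryEisensteinDescent` (BSD, rung W-ALL row 2·3@3), Kolyvagin column, Cassels–Tate lane: print item
`CasselsTateLevelInputsFact` (stmt-BirchSwinnertonDyer-20191), last input `hPTc` (Milne I Thm. 4.10 (a) for `Ш²(K, E[q])` in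
`PTChoice` cochain form, p628097).  The Ш²-cochain bridge (`Cruxes/WildKolyvaginUpperAtThree/SHA2-BRIDGE-w3g7.md`) moves the
`hPTc` hypothesis — stated with the DESCENDED Weil pairing `desc : E[m] × E[m] → μ_{m²}` and `E[m]`-valued cocycles — into the
currency of cell bsd-schneider's obstruction map `Ψ`, whose classes live in `H²(K, E[m]^D)`, `E[m]^D = Hom(E[m], μ_{m²})`
(`DiscreteGaloisModule.tateDual`), paired with `E[m]` by EVALUATION.  This file supplies (memo §1 (i) and (vii)):

* (A) the transport `θ′(S) = desc(S, ·) : E[m] → E[m]^D` and its bijectivity are seat w4 g2's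
  `…ShaTwoCochainThetaExhaustion` (`ShaTwoCochainTheta.descendHom_flip_smul`, `descDualHom_flip_bijective`), IMPORTED here;
* (E) for a `PTChoice` `C = (h; φ_v)` of `(f, g)`, a `2`-cocycle `F'` of `E[m]^D` and a `1`-cochain `α` of `E[m]^D` with
  `θ ∘ f − F' = dα` (i.e. `[F'] = θ_* [f]`), the data `h' := h − α ∪_ev g`, `φ'_v := θ ∘ φ_v − α|_v` form an admissible choice for
  `(F', g)` under the flipped evaluation pairing `ev♭ : E[m]^D × E[m] → μ_{m²}` (`dTwo_transportH`, `dOne_transportPhi`) whose local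
  `2`-cocycles are those of `C` ON THE NOSE (`transport_localCocycle_apply_eq`): `θ(S)(T) = desc(S, T)`.

So the sums of local terms of the `hPTc` hypothesis are sums of local terms of an admissible choice for `(F', g)` in the evaluation
currency — where `…ShaTwoCochainPairChoiceIndependence` (S1') compares them with the bridge's explicit choice (S2a/S2b).

THEOREMS ONLY (no definition, no instance, no named fact, no `sorry`); no case of BSD, Poitou–Tate or Cassels–Tate is proved.

## References
* [MilneADT2006] J. S. Milne, *Arithmetic Duality Theorems*, 2nd ed. (2006), I §2 (`M^D`), Thm. 4.10 (a); §6 proof of Prop. 6.9.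
* [SilvermanAEC2009] J. H. Silverman, *The Arithmetic of Elliptic Curves*, 2nd ed. (2009), III §8 Prop. 8.1 (Weil pairing:
  bilinear, alternating, non-degenerate, Galois equivariant).
-/

noncomputable section

open scoped Classical

universe u

-- `Summit.<P>.<Sub>` repeats `BirchSwinnertonDyer` by the tree's layout convention (D-0017)
set_option linter.dupNamespace false
set_option autoImplicit false

namespace Summit.BirchSwinnertonDyer.BirchSwinnertonDyer.Theorems.ShaTwoCochain

open CategoryTheory _root_.WeierstrassCurve Field Function NumberField
open Literature.NumberTheory.EllipticCurves
open Literature.NumberTheory.GaloisRepresentations Literature.NumberTheory.GaloisCohomology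
open Literature.NumberTheory.GaloisRepresentations.DiscreteGaloisModule (mu MuCarrier pairing TateDual tateDual tateDualEval
  tateDualPairing tateDualPairingLocal pairingDualHom pairingDualIntertwining)
open scoped ContRepresentation

variable {K : Type u} [Field K] [NumberField K] (W : WeierstrassCurve K) (m : ℕ) [NeZero m]
variable (e : geomTorsion W ((m * m : ℕ) : ℤ) → geomTorsion W ((m * m : ℕ) : ℤ) → AlgebraicClosure K)
  (hμ : ∀ S T, e S T ^ (m * m) = 1)
  (hadd₁ : ∀ S₁ S₂ T, e (S₁ + S₂) T = e S₁ T * e S₂ T)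
  (hadd₂ : ∀ S T₁ T₂, e S (T₁ + T₂) = e S T₁ * e S T₂)
  (hgal : ∀ (σ : absoluteGaloisGroup K) (S T : geomTorsion W ((m * m : ℕ) : ℤ)), σ • e S T = e (σ • S) (σ • T))

/-! ## (E) Transport of a `PTChoice` to the evaluation currency -/

section Transport

variable {W m e hμ hadd₁ hadd₂ hgal}
variable [Finite (geomTorsion W (m : ℤ))]
variable {f : contTwoCocycles (W.torsionGaloisModule (m : ℤ)).toTopRep}
  {g : contOneCocycles (W.torsionGaloisModule (m : ℤ)).toTopRep}
  (C : PTChoice W m e hμ hadd₁ hadd₂ hgal f g)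
  (F' : contTwoCocycles ((W.torsionGaloisModule (m : ℤ)).tateDual (m * m)).toTopRep)
  (α : C(absoluteGaloisGroup K, TateDual K (geomTorsion W (m : ℤ)) (m * m)))
  (hα : ∀ σ τ : absoluteGaloisGroup K,
    pairingDualHom (m * m) (descendHom W m m e hμ hadd₁ hadd₂).flip (f.1 (σ, τ)) - F'.1 (σ, τ) =
      (W.torsionGaloisModule (m : ℤ)).tateDual (m * m) σ (α τ) - α (σ * τ) + α σ)

include hα in
/-- **The transported global cochain `h' := h − α ∪_{ev♭} g` has `dh' = F' ∪_{ev♭} g`** (`ev♭` = the flipped evaluation pairing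
`E[m]^D × E[m] → μ_{m²}`): `d(α ∪ g) = dα ∪ g = θf ∪_{ev♭} g − F' ∪_{ev♭} g` (Leibniz, `dTwo_cochainCup₁₁`) and
`θf ∪_{ev♭} g = f ∪_desc g` pointwise (`θ(S)(T) = desc(S, T)`). [cite: MilneADT2006, I §6, proof of Prop. 6.9] -/
theorem dTwo_transportH (σ τ υ : absoluteGaloisGroup K) :
    (((tateDualPairing (W.torsionGaloisModule (m : ℤ)) (m * m)).flip).cupCocycle₂₁ F' g).1 (σ, τ, υ) =
      dTwo (mu K (m * m)).toTopRep
        (C.h - ((tateDualPairing (W.torsionGaloisModule (m : ℤ)) (m * m)).flip).cochainCup₁₁ α g) σ τ υ := by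
  have hL := ContPairing.dTwo_cochainCup₁₁ ((tateDualPairing (W.torsionGaloisModule (m : ℤ)) (m * m)).flip) α g
    (((W.torsionGaloisModule (m : ℤ)).tateDual (m * m)).twoCoboundary α) (fun σ τ => rfl) σ τ υ
  -- the evaluation pairing and differences of elements of `E[m]^D`, pointwise
  have key : ∀ (x : geomTorsion W (m : ℤ)) (y : TateDual K (geomTorsion W (m : ℤ)) (m * m)),
      (tateDualPairing (W.torsionGaloisModule (m : ℤ)) (m * m)).toLin x y = y x := fun _ _ => rfl
  have key2 : ∀ (Φ Ψ : TateDual K (geomTorsion W (m : ℤ)) (m * m)) (x : geomTorsion W (m : ℤ)),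
      (Φ - Ψ) x = Φ x - Ψ x := fun _ _ _ => rfl
  rw [dTwo_sub, ← C.dTwo_h, hL, ContPairing.cupCocycle₂₁_apply, ContPairing.cupCocycle₂₁_apply,
    ContPairing.cupCocycle₂₁_apply, ContinuousRep.twoCoboundary_apply, ← hα, ContPairing.flip_toLin_apply,
    ContPairing.flip_toLin_apply, descendPairing_toLin_apply, key, key, key2,
    DiscreteGaloisModule.pairingDualHom_apply_apply, AddMonoidHom.flip_apply]
  exact (sub_sub_cancel _ _).symm

include hα in
/-- **The transported local primitive `φ'_v := θ ∘ φ_v − α|_v` has `dφ'_v = F'_v`** (`θ` is equivariant and additive,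
`θ f_v = dθφ_v`, `θ f − F' = dα`). [cite: MilneADT2006, I §6, proof of Prop. 6.9] -/
theorem dOne_transportPhi (v : Place K) (σ τ : absoluteGaloisGroup (Place.Completion v)) :
    (resTwo ((W.torsionGaloisModule (m : ℤ)).tateDual (m * m)) (Place.Completion v) F').1 (σ, τ) =
      (DiscreteGaloisModule.toTopRep (GaloisRep.restrictField (Place.Completion v)
          ((W.torsionGaloisModule (m : ℤ)).tateDual (m * m)))).ρ σ
          (((⟨pairingDualHom (m * m) (descendHom W m m e hμ hadd₁ hadd₂).flip, continuous_of_discreteTopology⟩ :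
              C(geomTorsion W (m : ℤ), TateDual K (geomTorsion W (m : ℤ)) (m * m))).comp (C.φ v) -
            resCochain₁ (Place.Completion v) α) τ) -
        ((⟨pairingDualHom (m * m) (descendHom W m m e hμ hadd₁ hadd₂).flip, continuous_of_discreteTopology⟩ :
              C(geomTorsion W (m : ℤ), TateDual K (geomTorsion W (m : ℤ)) (m * m))).comp (C.φ v) -
            resCochain₁ (Place.Completion v) α) (σ * τ) +
        ((⟨pairingDualHom (m * m) (descendHom W m m e hμ hadd₁ hadd₂).flip, continuous_of_discreteTopology⟩ :
              C(geomTorsion W (m : ℤ), TateDual K (geomTorsion W (m : ℤ)) (m * m))).comp (C.φ v) -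
            resCochain₁ (Place.Completion v) α) σ := by
  have hf := C.dOne_φ v σ τ
  rw [resTwo_apply] at hf
  have hα' := hα (absGaloisRestrict K (Place.Completion v) σ) (absGaloisRestrict K (Place.Completion v) τ)
  -- the actions of `Γ_v` are those of `Γ_K` through `absGaloisRestrict`
  have kD : ∀ x, (DiscreteGaloisModule.toTopRep (GaloisRep.restrictField (Place.Completion v)
      ((W.torsionGaloisModule (m : ℤ)).tateDual (m * m)))).ρ σ x =
      (W.torsionGaloisModule (m : ℤ)).tateDual (m * m) (absGaloisRestrict K (Place.Completion v) σ) x := fun _ => rfl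
  have kA : ∀ S, (torsionRepAt W (Place.Completion v) (m : ℤ)).ρ σ S =
      (W.torsionGaloisModule (m : ℤ)) (absGaloisRestrict K (Place.Completion v) σ) S := fun _ => rfl
  rw [kA] at hf
  -- `θ` is additive and equivariant
  have hθf : pairingDualHom (m * m) (descendHom W m m e hμ hadd₁ hadd₂).flip
        (f.1 (absGaloisRestrict K (Place.Completion v) σ, absGaloisRestrict K (Place.Completion v) τ)) =
      (W.torsionGaloisModule (m : ℤ)).tateDual (m * m) (absGaloisRestrict K (Place.Completion v) σ)
          (pairingDualHom (m * m) (descendHom W m m e hμ hadd₁ hadd₂).flip (C.φ v τ)) -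
        pairingDualHom (m * m) (descendHom W m m e hμ hadd₁ hadd₂).flip (C.φ v (σ * τ)) +
        pairingDualHom (m * m) (descendHom W m m e hμ hadd₁ hadd₂).flip (C.φ v σ) := by
    rw [hf, map_add, map_sub, DiscreteGaloisModule.pairingDualHom_smul (ShaTwoCochainTheta.descendHom_flip_smul W m e hμ hadd₁ hadd₂ hgal)]
  -- `F' = θ f − dα`
  have hF' : F'.1 (absGaloisRestrict K (Place.Completion v) σ, absGaloisRestrict K (Place.Completion v) τ) =
      pairingDualHom (m * m) (descendHom W m m e hμ hadd₁ hadd₂).flip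
          (f.1 (absGaloisRestrict K (Place.Completion v) σ, absGaloisRestrict K (Place.Completion v) τ)) -
        ((W.torsionGaloisModule (m : ℤ)).tateDual (m * m) (absGaloisRestrict K (Place.Completion v) σ)
            (α (absGaloisRestrict K (Place.Completion v) τ)) -
          α (absGaloisRestrict K (Place.Completion v) σ * absGaloisRestrict K (Place.Completion v) τ) +
          α (absGaloisRestrict K (Place.Completion v) σ)) := by
    rw [← hα']; abel
  rw [resTwo_apply, hF', hθf, kD]
  simp only [ContinuousMap.sub_apply, ContinuousMap.comp_apply, ContinuousMap.coe_mk, resCochain₁_apply]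
  rw [map_mul (absGaloisRestrict K (Place.Completion v)) σ τ,
    map_sub ((W.torsionGaloisModule (m : ℤ)).tateDual (m * m) (absGaloisRestrict K (Place.Completion v) σ))]
  abel

include hα in
/-- The restricted boundary condition of the transported cochain: `d(h'|_v) = F'_v ∪_{ev♭} g_v` (from `dTwo_transportH`).
[folklore] -/
theorem dTwo_res_transportH (v : Place K) (σ τ υ : absoluteGaloisGroup (Place.Completion v)) :
    ((((tateDualPairing (W.torsionGaloisModule (m : ℤ)) (m * m)).flip).restrict (absGaloisRestrict K (Place.Completion v))).cupCocycle₂₁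
        (resTwo ((W.torsionGaloisModule (m : ℤ)).tateDual (m * m)) (Place.Completion v) F')
        (resOne (W.torsionGaloisModule (m : ℤ)) (Place.Completion v) g)).1 (σ, τ, υ) =
      dTwo (DiscreteGaloisModule.toTopRep (GaloisRep.restrictField (Place.Completion v) (mu K (m * m))))
        (resCochain₂ (Place.Completion v)
          (C.h - ((tateDualPairing (W.torsionGaloisModule (m : ℤ)) (m * m)).flip).cochainCup₁₁ α g)) σ τ υ := by
  have h0 := dTwo_transportH C F' α hα (absGaloisRestrict K (Place.Completion v) σ)
    (absGaloisRestrict K (Place.Completion v) τ) (absGaloisRestrict K (Place.Completion v) υ)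
  rw [ContPairing.cupCocycle₂₁_apply, dTwo_apply] at h0
  rw [ContPairing.cupCocycle₂₁_apply, dTwo_apply, ContPairing.restrict_toLin, resTwo_apply, resOne_apply, resOne_apply,
    resCochain₂_apply, resCochain₂_apply, resCochain₂_apply, resCochain₂_apply]
  simp only [map_mul (absGaloisRestrict K (Place.Completion v))]
  exact h0

/-- **The transported admissible choice has the SAME local `2`-cocycles as `C`, ON THE NOSE**: with
`φ'_v := θ ∘ φ_v − α|_v`, `h' := h − α ∪_{ev♭} g`,
`(φ'_v ∪_{ev♭} g_v − h'_v)(σ, τ) = (φ_v ∪_desc g_v − h_v)(σ, τ)` — because `θ(S)(T) = desc(S, T)` and the `α`-terms cancel.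
Hence the local terms (any `inv_v`) and their sums over any set of places agree. [cite: MilneADT2006, I §6, proof of Prop. 6.9] -/
theorem transport_localCocycle_apply_eq (v : Place K) (σ τ : absoluteGaloisGroup (Place.Completion v)) :
    ((((tateDualPairing (W.torsionGaloisModule (m : ℤ)) (m * m)).flip).restrict (absGaloisRestrict K (Place.Completion v))).cupSubCocycle
        ((⟨pairingDualHom (m * m) (descendHom W m m e hμ hadd₁ hadd₂).flip, continuous_of_discreteTopology⟩ :
              C(geomTorsion W (m : ℤ), TateDual K (geomTorsion W (m : ℤ)) (m * m))).comp (C.φ v) -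
            resCochain₁ (Place.Completion v) α)
        (resOne (W.torsionGaloisModule (m : ℤ)) (Place.Completion v) g)
        (resTwo ((W.torsionGaloisModule (m : ℤ)).tateDual (m * m)) (Place.Completion v) F')
        (dOne_transportPhi C F' α hα v)
        (resCochain₂ (Place.Completion v)
          (C.h - ((tateDualPairing (W.torsionGaloisModule (m : ℤ)) (m * m)).flip).cochainCup₁₁ α g))
        (dTwo_res_transportH C F' α hα v)).1 (σ, τ) =
      (C.localCocycle v).1 (σ, τ) := by
  have key : ∀ (x : geomTorsion W (m : ℤ)) (y : TateDual K (geomTorsion W (m : ℤ)) (m * m)),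
      (tateDualPairing (W.torsionGaloisModule (m : ℤ)) (m * m)).toLin x y = y x := fun _ _ => rfl
  have key2 : ∀ (Φ Ψ : TateDual K (geomTorsion W (m : ℤ)) (m * m)) (x : geomTorsion W (m : ℤ)),
      (Φ - Ψ) x = Φ x - Ψ x := fun _ _ _ => rfl
  rw [PTChoice.localCocycle, ContPairing.coe_cupSubCocycle, ContPairing.coe_cupSubCocycle, ContinuousMap.sub_apply,
    ContinuousMap.sub_apply, ContPairing.cochainCup₁₁_apply, ContPairing.cochainCup₁₁_apply, resCochain₂_apply,
    resCochain₂_apply, ContinuousMap.sub_apply, ContinuousMap.sub_apply, ContPairing.cochainCup₁₁_apply,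
    ContPairing.restrict_toLin, ContPairing.restrict_toLin, ContPairing.flip_toLin_apply, ContPairing.flip_toLin_apply,
    descendPairing_toLin_apply, key, key, resOne_apply, resOne_apply, map_mul (absGaloisRestrict K (Place.Completion v)) σ τ]
  simp only [ContinuousMap.comp_apply, ContinuousMap.coe_mk, resCochain₁_apply]
  rw [key2, DiscreteGaloisModule.pairingDualHom_apply_apply, AddMonoidHom.flip_apply]
  exact sub_sub_sub_cancel_right _ _ _

end Transport

end Summit.BirchSwinnertonDyer.BirchSwinnertonDyer.Theorems.ShaTwoCochain

end
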